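import Summits.QuantumFields.BalabanUV.Beta.GAN24.LayerPushGaugeTable

/-!
# `BalabanUV.Beta.GAN24.GaugeTableSlotByParts` — binder row G-an2-4 ∕ (CONV-C), W-slot CT-W, route «WC-TL» ∕ «QR-LL», row **(LT-Δ) «LAYER TRANSPORT»**, K-LL-4:
# **THE GAUGE-TABLE VERTEX BY SLOT SUMMATION BY PARTS — NO BINDER**: for ANY letter family `S κ u` (slot-summable at the kernel pair) and ANY bounded gauge
# function `λ_{νU}`, the table vertex through the pure-gauge table leg `dz λ_{νU}` is the gauge function's VALUES read against the letter's SLOT DIVERGENCE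
# (an2's `KernelWard.divV`): `vertexW (dz λ) S ν U = Σ'_u λ_{νU}(u) • divV S u`; the total slot divergence vanishes, so ANY base value may be subtracted:
# `= Σ'_u (λ_{νU}(u) − c) • divV S u`; hence `|vertexW (dz λ) S ν U x z a b| ≤ Σ'_u |λ_{νU}(u) − c|·|(divV S u) x z a b|`, and under the (LAY) profile row the
# slot divergence carries the letter's own profile with the weight `ω̃ u = e^{2m′}·Σ_κ ω(u − e_κ) + (d+1)·ω u` — the (b3) vertex for the LITERAL letters, which need
# NOT satisfy `LayerPushGaugeTable`'s slot-Ward binder (my Q-66-1, journal R-leaf01-g66-1): what the gauge table leg feeds the vertex is `|λ − c|` ON THE LETTER's SLOTS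

NOT IN PRINT; OUR BOOKKEEPING ([folklore] Abel summation in the table slot + the shift invariance of `tsum` on `ℤ^{d+1}`; G-an2-4 formalisation swarm, leaf prover
`b2b-balaban-gan24-formalise-leaf-01`, gen 66).  HONEST FRAMING (cell contract, verbatim): «discharging `BetaPertH` makes Bałaban's UV stability UNCONDITIONAL — a real
constructive-QFT result; it is NOT the continuum limit and NOT the Clay problem.»  HONEST DEPENDENCY (verbatim): «continuum YM on T⁴ ⇐ BetaPertH ∧ nine spine estimates
(0/9 proved); BetaPertH ⇐ (D1) ∧ (D4) ∧ CAP+tail; G-an2-4 gates asym, D1 and NE2/3/4.»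

## What (generic `d`; `S : Fin (d+1) → Site → MKer`, a gauge function family `lam ν U : Site → ℝ` bounded by `Lbar`, the kernel entry `(x, z, a, b)` fixed,
## slot-summability `∀ κ, Summable (u ↦ S κ u x z a b)`)
§1 `summable_mul_slot ∕ summable_mul_slot_shift`, **`vertexW_dz_eq_tsum_mul_divV`**: `vertexW (dz∘lam) S ν U x z a b = Σ'_u lam ν U u · (divV S u) x z a b`.
§2 **`tsum_divV_apply_eq_zero`**: `Σ'_u (divV S u) x z a b = 0`; `summable_divV_apply`.
§3 **`vertexW_dz_eq_tsum_sub_const_mul_divV`**: `vertexW (dz∘lam) S ν U x z a b = Σ'_u (lam ν U u − c) · (divV S u) x z a b` for every `c`.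
§4 **`abs_vertexW_dz_le_tsum`**: `|vertexW (dz∘lam) S ν U x z a b| ≤ Σ'_u |lam ν U u − c|·|(divV S u) x z a b|`.
§5 **`abs_divV_apply_le_of_profile`**: under `|S κ u x z a b| ≤ Cs·ω u·e^{−m′(‖x−u‖₁+‖z−u‖₁)}` (`0 ≤ Cs, m′, ω`):
   `|(divV S u) x z a b| ≤ Cs·(e^{2m′}·Σ_κ ω (u − e_κ) + (d+1)·ω u)·e^{−m′(‖x−u‖₁+‖z−u‖₁)}` — the slot divergence obeys the letter's profile row with the weight `ω̃`;
   **`abs_vertexW_dz_le_of_profile`**: `|vertexW (dz∘lam) S ν U x z a b| ≤ Cs·Σ'_u |lam ν U u − c|·ω̃ u·e^{−m′(‖x−u‖₁+‖z−u‖₁)}` (given that majorant is summable).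
READING (displayed, not claimed beyond the theorems): choose `c` = the gauge function's value on the block side of the letter's layer; then `|lam − c|` on the letter's
slots across the block face IS the inter-block jump of the dressed legs' gauge part — the located input (3) of my R-1; nothing here makes it small.  K-LL-4 NOT advanced,
only made binder-free.  [folklore]; 0 cited facts, 0 `def`, 0 `def … : Prop`, 0 sorry.  NOTHING of (Q-R)∕(LT)∕(Q-L)∕(C)∕(S)∕«T2Shape»∕«T2Drift»∕(hW, hWall) discharged;
NEVER «G-an2-4 closed» as (CONV-C); NOT D1, NOT `BetaPertH`, NOT continuum, NOT Clay.  2026-08-22; no existing file touched.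
-/

noncomputable section

open Finset
open scoped BigOperators
open Literature.MathematicalPhysics.QuantumFieldTheory
open Literature.MathematicalPhysics.QuantumFieldTheory.Balaban1983to89
open Literature.MathematicalPhysics.QuantumFieldTheory.Balaban1983to89.Beta
open B12Sec2to5 (l1 l1_nonneg)
open ExpKernelCalculus (MKer Site)
open OneStepResolventKernel (Fib)
open AffineAveraging (dz)
open KernelWard (divV)
open AveragingWardStencils (b6UnitVec_eq)
open Summit.QuantumFields.BalabanUV.Beta.GAN24.Push4 (vertexW vertexW_apply)

namespace Summit.QuantumFields.BalabanUV.Beta.GAN24.GaugeTableSlotByParts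

variable {d : ℕ}

/-! ## §1 Slot summation by parts -/

section ByParts

variable {S : Fin (d + 1) → Site (d + 1) → MKer (d + 1) (Fib d)} {lam : Fin (d + 1) → Site (d + 1) → Site (d + 1) → ℝ} {Lbar : ℝ}
  (hlam : ∀ ν U u, |lam ν U u| ≤ Lbar) {x z : Site (d + 1)} {a b : Fib d} (hSs : ∀ κ, Summable fun u => S κ u x z a b)

include hlam hSs in
/-- [folklore] A bounded gauge function times a slot-summable letter entry is slot-summable. -/
theorem summable_mul_slot (ν : Fin (d + 1)) (U : Site (d + 1)) (κ : Fin (d + 1)) :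
    Summable fun u => lam ν U u * S κ u x z a b := by
  refine Summable.of_norm_bounded ((hSs κ).abs.mul_left Lbar) (fun u => ?_)
  rw [Real.norm_eq_abs, abs_mul]
  exact mul_le_mul_of_nonneg_right (hlam ν U u) (abs_nonneg _)

include hSs in
/-- [folklore] Slot-summability is shift invariant: `u ↦ S κ (u − e) x z a b` is summable. -/
theorem summable_slot_shift (κ : Fin (d + 1)) (e : Site (d + 1)) : Summable fun u => S κ (u - e) x z a b :=
  (Equiv.subRight e).summable_iff.2 (hSs κ)

include hlam hSs in
/-- [folklore] … and so is its product with the bounded gauge function. -/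
theorem summable_mul_slot_shift (ν : Fin (d + 1)) (U : Site (d + 1)) (κ : Fin (d + 1)) (e : Site (d + 1)) :
    Summable fun u => lam ν U u * S κ (u - e) x z a b := by
  refine Summable.of_norm_bounded ((summable_slot_shift hSs κ e).abs.mul_left Lbar) (fun u => ?_)
  rw [Real.norm_eq_abs, abs_mul]
  exact mul_le_mul_of_nonneg_right (hlam ν U u) (abs_nonneg _)

/-- [folklore] an2's slot divergence, entrywise, in the `AffineAveraging.unitVec` spelling. -/
theorem divV_apply (S : Fin (d + 1) → Site (d + 1) → MKer (d + 1) (Fib d)) (u x z : Site (d + 1)) (a b : Fib d) :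
    divV S u x z a b = ∑ κ : Fin (d + 1), (S κ (u - AffineAveraging.unitVec κ) x z a b - S κ u x z a b) := by
  simp only [divV, Finset.sum_apply, Pi.sub_apply, b6UnitVec_eq]

include hlam hSs in
/-- NOT IN PRINT; OUR BOOKKEEPING.  **SLOT SUMMATION BY PARTS**: the table vertex through a pure-gauge table leg reads the gauge function's VALUES against the
letter's slot divergence — `vertexW (dz∘lam) S ν U x z a b = Σ'_u lam ν U u · (divV S u) x z a b` (no binder; shift the `u + e_κ` term of `dz`). -/
theorem vertexW_dz_eq_tsum_mul_divV (ν : Fin (d + 1)) (U : Site (d + 1)) :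
    vertexW (fun ν U κ u => dz (lam ν U) κ u) S ν U x z a b = ∑' u : Site (d + 1), lam ν U u * divV S u x z a b := by
  rw [vertexW_apply]
  have hκ : ∀ κ : Fin (d + 1), ∑' u : Site (d + 1), dz (lam ν U) κ u * S κ u x z a b
      = ∑' u : Site (d + 1), lam ν U u * (S κ (u - AffineAveraging.unitVec κ) x z a b - S κ u x z a b) := by
    intro κ
    have e1 : ∀ u, dz (lam ν U) κ u * S κ u x z a b
        = lam ν U (u + AffineAveraging.unitVec κ) * S κ u x z a b - lam ν U u * S κ u x z a b := fun u => by
      simp only [dz]; ring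
    rw [tsum_congr e1, Summable.tsum_sub ?h1 (summable_mul_slot hlam hSs ν U κ)]
    case h1 =>
      have h0 : Summable ((fun v => lam ν U v * S κ (v - AffineAveraging.unitVec κ) x z a b) ∘ (Equiv.addRight (AffineAveraging.unitVec κ))) :=
        (Equiv.addRight (AffineAveraging.unitVec κ)).summable_iff.2 (summable_mul_slot_shift hlam hSs ν U κ (AffineAveraging.unitVec κ))
      exact h0.congr fun u => by simp only [Function.comp, Equiv.coe_addRight, add_sub_cancel_right]
    -- shift the first series: `Σ'_u lam (u + e) · S κ u = Σ'_v lam v · S κ (v − e)`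
    have e2 : ∑' u : Site (d + 1), lam ν U (u + AffineAveraging.unitVec κ) * S κ u x z a b
        = ∑' v : Site (d + 1), lam ν U v * S κ (v - AffineAveraging.unitVec κ) x z a b := by
      rw [← (Equiv.addRight (AffineAveraging.unitVec κ)).tsum_eq (fun v => lam ν U v * S κ (v - AffineAveraging.unitVec κ) x z a b)]
      refine tsum_congr fun u => ?_
      simp only [Equiv.coe_addRight, add_sub_cancel_right]
    rw [e2, ← Summable.tsum_sub (summable_mul_slot_shift hlam hSs ν U κ _) (summable_mul_slot hlam hSs ν U κ)]
    exact tsum_congr fun u => by ring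
  rw [Finset.sum_congr rfl fun κ _ => hκ κ, ← Summable.tsum_finsetSum (fun κ _ => ?_)]
  · refine tsum_congr fun u => ?_
    rw [divV_apply, Finset.mul_sum]
  · exact ((summable_mul_slot_shift hlam hSs ν U κ _).sub (summable_mul_slot hlam hSs ν U κ)).congr fun u => by ring

/-! ## §2 The total slot divergence vanishes -/

include hSs in
/-- [folklore] The slot divergence is slot-summable at the kernel entry. -/
theorem summable_divV_apply : Summable fun u => divV S u x z a b := by
  have e : (fun u => divV S u x z a b) = fun u => ∑ κ : Fin (d + 1), (S κ (u - AffineAveraging.unitVec κ) x z a b - S κ u x z a b) :=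
    funext fun u => divV_apply S u x z a b
  rw [e]
  exact summable_sum fun κ _ => (summable_slot_shift hSs κ _).sub (hSs κ)

include hSs in
/-- NOT IN PRINT; OUR BOOKKEEPING.  **THE TOTAL SLOT DIVERGENCE VANISHES** (telescoping = shift invariance of the series): `Σ'_u (divV S u) x z a b = 0`. -/
theorem tsum_divV_apply_eq_zero : ∑' u : Site (d + 1), divV S u x z a b = 0 := by
  have e : (fun u => divV S u x z a b) = fun u => ∑ κ : Fin (d + 1), (S κ (u - AffineAveraging.unitVec κ) x z a b - S κ u x z a b) :=
    funext fun u => divV_apply S u x z a b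
  rw [e, Summable.tsum_finsetSum (fun κ _ => (summable_slot_shift hSs κ _).sub (hSs κ))]
  refine Finset.sum_eq_zero fun κ _ => ?_
  rw [Summable.tsum_sub (summable_slot_shift hSs κ _) (hSs κ)]
  have h := (Equiv.subRight (AffineAveraging.unitVec κ)).tsum_eq (fun v => S κ v x z a b)
  simp only [Equiv.subRight_apply] at h
  rw [h, sub_self]

/-! ## §3 Re-centring and the bound -/

include hlam hSs in
/-- NOT IN PRINT; OUR BOOKKEEPING.  **RE-CENTRED FORM**: for every constant `c`, `vertexW (dz∘lam) S ν U x z a b = Σ'_u (lam ν U u − c) · (divV S u) x z a b` — only the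
gauge function's values RELATIVE TO A BASE VALUE are read (the commutator kills constants, binder or not). -/
theorem vertexW_dz_eq_tsum_sub_const_mul_divV (ν : Fin (d + 1)) (U : Site (d + 1)) (c : ℝ) :
    vertexW (fun ν U κ u => dz (lam ν U) κ u) S ν U x z a b = ∑' u : Site (d + 1), (lam ν U u - c) * divV S u x z a b := by
  have hD := summable_divV_apply (S := S) (x := x) (z := z) (a := a) (b := b) hSs
  have hlD : Summable fun u => lam ν U u * divV S u x z a b := by
    refine Summable.of_norm_bounded (hD.abs.mul_left Lbar) (fun u => ?_)
    rw [Real.norm_eq_abs, abs_mul]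
    exact mul_le_mul_of_nonneg_right (hlam ν U u) (abs_nonneg _)
  rw [vertexW_dz_eq_tsum_mul_divV hlam hSs ν U]
  have e : ∀ u, (lam ν U u - c) * divV S u x z a b = lam ν U u * divV S u x z a b - c * divV S u x z a b := fun u => by ring
  rw [tsum_congr e, Summable.tsum_sub hlD (hD.mul_left c), tsum_mul_left, tsum_divV_apply_eq_zero hSs, mul_zero, sub_zero]

include hlam hSs in
/-- NOT IN PRINT; OUR BOOKKEEPING.  **THE BINDER-FREE (b3) VERTEX BOUND**: `|vertexW (dz∘lam) S ν U x z a b| ≤ Σ'_u |lam ν U u − c|·|(divV S u) x z a b|` for every `c`. -/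
theorem abs_vertexW_dz_le_tsum (ν : Fin (d + 1)) (U : Site (d + 1)) (c : ℝ) :
    |vertexW (fun ν U κ u => dz (lam ν U) κ u) S ν U x z a b| ≤ ∑' u : Site (d + 1), |lam ν U u - c| * |divV S u x z a b| := by
  have hD := summable_divV_apply (S := S) (x := x) (z := z) (a := a) (b := b) hSs
  have hg : Summable fun u => |lam ν U u - c| * |divV S u x z a b| := by
    refine Summable.of_norm_bounded (hD.abs.mul_left (Lbar + |c|)) (fun u => ?_)
    rw [Real.norm_eq_abs, abs_mul, abs_abs, abs_abs]
    refine mul_le_mul_of_nonneg_right ((abs_sub _ _).trans (by linarith [hlam ν U u])) (abs_nonneg _)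
  rw [vertexW_dz_eq_tsum_sub_const_mul_divV hlam hSs ν U c, ← Real.norm_eq_abs]
  exact tsum_of_norm_bounded hg.hasSum fun u => by rw [Real.norm_eq_abs, abs_mul]

end ByParts

/-! ## §5 The slot divergence under the (LAY) profile row -/

section Profile

variable {S : Fin (d + 1) → Site (d + 1) → MKer (d + 1) (Fib d)} {ω : Site (d + 1) → ℝ} {Cs m' : ℝ}
  (hCs : 0 ≤ Cs) (hm : 0 ≤ m') (hω : ∀ u, 0 ≤ ω u)
  (hS : ∀ k' u x z a b, |S k' u x z a b| ≤ Cs * ω u * Real.exp (-m' * (l1 (x - u) + l1 (z - u))))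

/-- [folklore] Shifting the slot by a unit vector costs at most `e^{2m′}` in the two-sided profile: `e^{−m′(‖x−(u−e)‖₁+‖z−(u−e)‖₁)} ≤ e^{2m′}·e^{−m′(‖x−u‖₁+‖z−u‖₁)}`. -/
theorem exp_profile_shift_le (hm : 0 ≤ m') (x z u : Site (d + 1)) (κ : Fin (d + 1)) :
    Real.exp (-m' * (l1 (x - (u - AffineAveraging.unitVec κ)) + l1 (z - (u - AffineAveraging.unitVec κ))))
      ≤ Real.exp (2 * m') * Real.exp (-m' * (l1 (x - u) + l1 (z - u))) := by
  rw [← Real.exp_add]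
  refine Real.exp_le_exp.2 ?_
  have h1 : l1 (x - u) ≤ l1 (x - (u - AffineAveraging.unitVec κ)) + l1 ((u - AffineAveraging.unitVec κ) - u) :=
    ExpKernelCalculus.l1_sub_triangle x (u - AffineAveraging.unitVec κ) u
  have h2 : l1 (z - u) ≤ l1 (z - (u - AffineAveraging.unitVec κ)) + l1 ((u - AffineAveraging.unitVec κ) - u) :=
    ExpKernelCalculus.l1_sub_triangle z (u - AffineAveraging.unitVec κ) u
  have h3 : l1 ((u - AffineAveraging.unitVec κ) - u) = 1 := by
    rw [sub_sub_cancel_left, show l1 (-AffineAveraging.unitVec (d := d + 1) κ) = l1 (AffineAveraging.unitVec (d := d + 1) κ) by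
      unfold l1; simp]
    unfold l1
    rw [Finset.sum_eq_single κ]
    · simp [AffineAveraging.unitVec]
    · intro μ _ hμ; simp [AffineAveraging.unitVec, hμ]
    · intro h; exact absurd (Finset.mem_univ κ) h
  rw [h3] at h1 h2
  nlinarith

include hCs hm hω hS in
/-- NOT IN PRINT; OUR BOOKKEEPING.  **THE SLOT DIVERGENCE OBEYS THE LETTER's PROFILE ROW** with the weight `ω̃ u = e^{2m′}·Σ_κ ω(u − e_κ) + (d+1)·ω u`:
`|(divV S u) x z a b| ≤ Cs·(e^{2m′}·Σ_κ ω (u − e_κ) + (d+1)·ω u)·e^{−m′(‖x−u‖₁+‖z−u‖₁)}`. -/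
theorem abs_divV_apply_le_of_profile (u x z : Site (d + 1)) (a b : Fib d) :
    |divV S u x z a b| ≤ Cs * (Real.exp (2 * m') * (∑ κ : Fin (d + 1), ω (u - AffineAveraging.unitVec κ)) + ((d : ℝ) + 1) * ω u)
      * Real.exp (-m' * (l1 (x - u) + l1 (z - u))) := by
  rw [divV_apply]
  refine (Finset.abs_sum_le_sum_abs _ _).trans ?_
  have hterm : ∀ κ : Fin (d + 1), |S κ (u - AffineAveraging.unitVec κ) x z a b - S κ u x z a b|
      ≤ Cs * (Real.exp (2 * m') * ω (u - AffineAveraging.unitVec κ) + ω u) * Real.exp (-m' * (l1 (x - u) + l1 (z - u))) := by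
    intro κ
    have h1 := hS κ (u - AffineAveraging.unitVec κ) x z a b
    have h1' : |S κ (u - AffineAveraging.unitVec κ) x z a b|
        ≤ Cs * ω (u - AffineAveraging.unitVec κ) * (Real.exp (2 * m') * Real.exp (-m' * (l1 (x - u) + l1 (z - u)))) :=
      h1.trans (mul_le_mul_of_nonneg_left (exp_profile_shift_le hm x z u κ) (mul_nonneg hCs (hω _)))
    have h2 := hS κ u x z a b
    calc |S κ (u - AffineAveraging.unitVec κ) x z a b - S κ u x z a b|
        ≤ |S κ (u - AffineAveraging.unitVec κ) x z a b| + |S κ u x z a b| := abs_sub _ _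
      _ ≤ Cs * ω (u - AffineAveraging.unitVec κ) * (Real.exp (2 * m') * Real.exp (-m' * (l1 (x - u) + l1 (z - u))))
          + Cs * ω u * Real.exp (-m' * (l1 (x - u) + l1 (z - u))) := add_le_add h1' h2
      _ = Cs * (Real.exp (2 * m') * ω (u - AffineAveraging.unitVec κ) + ω u) * Real.exp (-m' * (l1 (x - u) + l1 (z - u))) := by ring
  refine (Finset.sum_le_sum fun κ _ => hterm κ).trans (le_of_eq ?_)
  rw [← Finset.sum_mul, ← Finset.mul_sum, Finset.sum_add_distrib, Finset.mul_sum, Finset.sum_const, Finset.card_univ, Fintype.card_fin]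
  simp only [nsmul_eq_mul, Nat.cast_add, Nat.cast_one]

end Profile

/-! ## §6 The binder-free (b3) vertex under the profile row -/

section Both

variable {S : Fin (d + 1) → Site (d + 1) → MKer (d + 1) (Fib d)} {lam : Fin (d + 1) → Site (d + 1) → Site (d + 1) → ℝ} {Lbar : ℝ}
  (hlam : ∀ ν U u, |lam ν U u| ≤ Lbar)
  {ω : Site (d + 1) → ℝ} {Cs m' : ℝ} (hCs : 0 ≤ Cs) (hm : 0 ≤ m') (hω : ∀ u, 0 ≤ ω u)
  (hS : ∀ k' u x z a b, |S k' u x z a b| ≤ Cs * ω u * Real.exp (-m' * (l1 (x - u) + l1 (z - u))))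

include hlam hCs hm hω hS in
/-- NOT IN PRINT; OUR BOOKKEEPING.  **WHAT THE GAUGE TABLE LEG FEEDS THE VERTEX IS `|λ − c|` ON THE LETTER's SLOTS**: if the letter is slot-summable at `(x, z, a, b)` and
the majorant `u ↦ |lam ν U u − c|·ω̃ u·e^{−m′(‖x−u‖₁+‖z−u‖₁)}` is summable, then
`|vertexW (dz∘lam) S ν U x z a b| ≤ Cs·Σ'_u |lam ν U u − c|·(e^{2m′}·Σ_κ ω(u−e_κ) + (d+1)·ω u)·e^{−m′(‖x−u‖₁+‖z−u‖₁)}`. -/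
theorem abs_vertexW_dz_le_of_profile {x z : Site (d + 1)} {a b : Fib d} (hSs : ∀ κ, Summable fun u => S κ u x z a b)
    (ν : Fin (d + 1)) (U : Site (d + 1)) (c : ℝ)
    (hmaj : Summable fun u => |lam ν U u - c| * ((Real.exp (2 * m') * (∑ κ : Fin (d + 1), ω (u - AffineAveraging.unitVec κ)) + ((d : ℝ) + 1) * ω u)
      * Real.exp (-m' * (l1 (x - u) + l1 (z - u))))) :
    |vertexW (fun ν U κ u => dz (lam ν U) κ u) S ν U x z a b|
      ≤ Cs * ∑' u : Site (d + 1), |lam ν U u - c| * ((Real.exp (2 * m') * (∑ κ : Fin (d + 1), ω (u - AffineAveraging.unitVec κ)) + ((d : ℝ) + 1) * ω u)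
          * Real.exp (-m' * (l1 (x - u) + l1 (z - u)))) := by
  refine (abs_vertexW_dz_le_tsum hlam hSs ν U c).trans ?_
  rw [← tsum_mul_left]
  have hg : Summable fun u => Cs * (|lam ν U u - c| * ((Real.exp (2 * m') * (∑ κ : Fin (d + 1), ω (u - AffineAveraging.unitVec κ)) + ((d : ℝ) + 1) * ω u)
      * Real.exp (-m' * (l1 (x - u) + l1 (z - u))))) := hmaj.mul_left Cs
  refine Summable.tsum_le_tsum (fun u => ?_) ?_ hg
  · calc |lam ν U u - c| * |divV S u x z a b|
        ≤ |lam ν U u - c| * (Cs * (Real.exp (2 * m') * (∑ κ : Fin (d + 1), ω (u - AffineAveraging.unitVec κ)) + ((d : ℝ) + 1) * ω u)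
            * Real.exp (-m' * (l1 (x - u) + l1 (z - u)))) :=
          mul_le_mul_of_nonneg_left (abs_divV_apply_le_of_profile hCs hm hω hS u x z a b) (abs_nonneg _)
      _ = _ := by ring
  · exact Summable.of_norm_bounded hg (fun u => by
      rw [Real.norm_eq_abs, abs_mul, abs_abs, abs_abs]
      calc |lam ν U u - c| * |divV S u x z a b|
          ≤ |lam ν U u - c| * (Cs * (Real.exp (2 * m') * (∑ κ : Fin (d + 1), ω (u - AffineAveraging.unitVec κ)) + ((d : ℝ) + 1) * ω u)
              * Real.exp (-m' * (l1 (x - u) + l1 (z - u)))) :=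
            mul_le_mul_of_nonneg_left (abs_divV_apply_le_of_profile hCs hm hω hS u x z a b) (abs_nonneg _)
        _ = _ := by ring)

end Both

end Summit.QuantumFields.BalabanUV.Beta.GAN24.GaugeTableSlotByParts

end
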